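import Summits.SmoothPoincare4.SmoothPoincare4.Theses.CongruenceShadows
import Summits.SmoothPoincare4.SmoothPoincare4.Theorems.CongruenceShadowsHeegaardHandlebodyCongruenceClosedStubRegluingDepth

/-!
# Stub P3 partial — DEEP REDUCTION: "limits are simply connected" may assume the gluing is trivial modulo any one level
# (line `pair-rigidity-retraction`, crux `CongruenceShadows.HeegaardHandlebodyCongruenceClosed`, stmt-SmoothPoincare4-14596)

Notation: `S = S_{3+3m}`, `N = (N₀,N₁,N₂) = s4Kernels.stabilizeIter m`, `H = Stab N₀ ∩ Stab N₁`, `C = Stab N₂`,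
`T_ρ = N₀ ⊔ N₁ ⊔ ρN₂`, "product-congruent" (PC) = the crux hypothesis on `ρ`.

The landed regluing depth (`regluingDepth`) rewrites `T_ρ = x(T_γ)` with `x ∈ H` and `γ := x⁻¹ ∘ ρ ∘ c⁻¹ ≡ id (mod M₀)`
for any one level `M₀` at which `ρ ≡ x ∘ c`.  Here we add that product-congruence itself PASSES to `γ`
(`productCongruent_regluing`: `H·cl(HC)·C = cl(HC)`), so that the open stub P3 at a genus is EQUIVALENT to its
restriction to automorphisms that are the identity modulo an arbitrary prescribed characteristic finite-index level
(`p3_of_deep`, registered as `stub_deepReduction`): a proof of P3 may start from a gluing map as deep in the congruence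
topology as it likes (Torelli mod `n`, any term of a characteristic series, …), and a counterexample, if any, exists at
every depth.
-/

noncomputable section

-- the prescribed namespace `Summit.<P>.<Sub>.…` duplicates `SmoothPoincare4` (P = Sub)
set_option linter.dupNamespace false

namespace Summit.SmoothPoincare4.SmoothPoincare4.Theorems.HeegaardHandlebodyCongruenceClosed.PairRigidityRetraction

open Literature.Topology.FourManifolds Subgroup

/-- **Product-congruence passes to the deep regluing.**  If `x ∈ H`, `c ∈ C` and `ρ` is product-congruent at every
characteristic finite-index level, then so is `γ := x⁻¹ ∘ ρ ∘ c⁻¹` (`= (c.symm.trans ρ).trans x.symm`): at level `M`,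
`ρ ≡ x' ∘ c'` gives `γ ≡ (x⁻¹x') ∘ (c'c⁻¹)`. [folklore] -/
theorem productCongruent_regluing {m : ℕ} {ρ x c : SurfaceGroup (3 + 3 * m) ≃* SurfaceGroup (3 + 3 * m)}
    (hx0 : (s4Kernels.stabilizeIter m 0).map x.toMonoidHom = s4Kernels.stabilizeIter m 0)
    (hx1 : (s4Kernels.stabilizeIter m 1).map x.toMonoidHom = s4Kernels.stabilizeIter m 1)
    (hc : (s4Kernels.stabilizeIter m 2).map c.toMonoidHom = s4Kernels.stabilizeIter m 2)
    (h : ∀ M : Subgroup (SurfaceGroup (3 + 3 * m)), M.Characteristic → M.FiniteIndex →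
      ∃ x c : SurfaceGroup (3 + 3 * m) ≃* SurfaceGroup (3 + 3 * m),
        (s4Kernels.stabilizeIter m 0).map x.toMonoidHom = s4Kernels.stabilizeIter m 0 ∧
        (s4Kernels.stabilizeIter m 1).map x.toMonoidHom = s4Kernels.stabilizeIter m 1 ∧
        (s4Kernels.stabilizeIter m 2).map c.toMonoidHom = s4Kernels.stabilizeIter m 2 ∧
        ∀ s, ρ s * (x (c s))⁻¹ ∈ M) :
    ∀ M : Subgroup (SurfaceGroup (3 + 3 * m)), M.Characteristic → M.FiniteIndex →
      ∃ x' c' : SurfaceGroup (3 + 3 * m) ≃* SurfaceGroup (3 + 3 * m),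
        (s4Kernels.stabilizeIter m 0).map x'.toMonoidHom = s4Kernels.stabilizeIter m 0 ∧
        (s4Kernels.stabilizeIter m 1).map x'.toMonoidHom = s4Kernels.stabilizeIter m 1 ∧
        (s4Kernels.stabilizeIter m 2).map c'.toMonoidHom = s4Kernels.stabilizeIter m 2 ∧
        ∀ s, ((c.symm.trans ρ).trans x.symm) s * (x' (c' s))⁻¹ ∈ M := by
  intro M hM hF
  obtain ⟨x', c', hx'0, hx'1, hc', h'⟩ := h M hM hF
  refine ⟨x'.trans x.symm, c.symm.trans c', ?_, ?_, ?_, ?_⟩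
  · exact map_trans_eq_of_map_eq hx'0 (map_symm_eq_of_map_eq x hx0)
  · exact map_trans_eq_of_map_eq hx'1 (map_symm_eq_of_map_eq x hx1)
  · exact map_trans_eq_of_map_eq (map_symm_eq_of_map_eq c hc) hc'
  · intro s
    simpa [map_mul, map_inv] using apply_mem_of_characteristic hM x.symm (h' (c.symm s))

/-- **Deep reduction.**  Fix any characteristic finite-index level `M₀`.  If "limits are simply connected" holds at
genus `3+3m` for every product-congruent automorphism that is the IDENTITY modulo `M₀`, then it holds for every
product-congruent automorphism: by `regluingDepth`, `T_ρ = x(T_γ)` with `γ ≡ id (mod M₀)` product-congruent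
(`productCongruent_regluing`), and `x(T_γ) = ⊤ ↔ T_γ = ⊤`. [folklore] -/
theorem p3_of_deep {m : ℕ} (M₀ : Subgroup (SurfaceGroup (3 + 3 * m))) (hM₀ : M₀.Characteristic) (hF₀ : M₀.FiniteIndex)
    (hdeep : ∀ γ : SurfaceGroup (3 + 3 * m) ≃* SurfaceGroup (3 + 3 * m), (∀ s, γ s * s⁻¹ ∈ M₀) →
      (∀ M : Subgroup (SurfaceGroup (3 + 3 * m)), M.Characteristic → M.FiniteIndex →
        ∃ x c : SurfaceGroup (3 + 3 * m) ≃* SurfaceGroup (3 + 3 * m),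
          (s4Kernels.stabilizeIter m 0).map x.toMonoidHom = s4Kernels.stabilizeIter m 0 ∧
          (s4Kernels.stabilizeIter m 1).map x.toMonoidHom = s4Kernels.stabilizeIter m 1 ∧
          (s4Kernels.stabilizeIter m 2).map c.toMonoidHom = s4Kernels.stabilizeIter m 2 ∧
          ∀ s, γ s * (x (c s))⁻¹ ∈ M) →
      s4Kernels.stabilizeIter m 0 ⊔ s4Kernels.stabilizeIter m 1 ⊔ (s4Kernels.stabilizeIter m 2).map γ.toMonoidHom = ⊤)
    (ρ : SurfaceGroup (3 + 3 * m) ≃* SurfaceGroup (3 + 3 * m))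
    (hρ : ∀ M : Subgroup (SurfaceGroup (3 + 3 * m)), M.Characteristic → M.FiniteIndex →
      ∃ x c : SurfaceGroup (3 + 3 * m) ≃* SurfaceGroup (3 + 3 * m),
        (s4Kernels.stabilizeIter m 0).map x.toMonoidHom = s4Kernels.stabilizeIter m 0 ∧
        (s4Kernels.stabilizeIter m 1).map x.toMonoidHom = s4Kernels.stabilizeIter m 1 ∧
        (s4Kernels.stabilizeIter m 2).map c.toMonoidHom = s4Kernels.stabilizeIter m 2 ∧
        ∀ s, ρ s * (x (c s))⁻¹ ∈ M) :
    s4Kernels.stabilizeIter m 0 ⊔ s4Kernels.stabilizeIter m 1 ⊔ (s4Kernels.stabilizeIter m 2).map ρ.toMonoidHom = ⊤ := by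
  obtain ⟨x, c, hx0, hx1, hc, h⟩ := hρ M₀ hM₀ hF₀
  have hγ := hdeep ((c.symm.trans ρ).trans x.symm) (regluing_congr_id hM₀ h) (productCongruent_regluing hx0 hx1 hc hρ)
  rw [sup_map_eq_map_regluing ρ hx0 hx1 hc, map_equiv_eq_top_iff]
  exact hγ

/-- **The reduction is an equivalence** (the converse is restriction). [folklore] -/
theorem p3_iff_deep {m : ℕ} (M₀ : Subgroup (SurfaceGroup (3 + 3 * m))) (hM₀ : M₀.Characteristic) (hF₀ : M₀.FiniteIndex) :
    (∀ ρ : SurfaceGroup (3 + 3 * m) ≃* SurfaceGroup (3 + 3 * m),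
      (∀ M : Subgroup (SurfaceGroup (3 + 3 * m)), M.Characteristic → M.FiniteIndex →
        ∃ x c : SurfaceGroup (3 + 3 * m) ≃* SurfaceGroup (3 + 3 * m),
          (s4Kernels.stabilizeIter m 0).map x.toMonoidHom = s4Kernels.stabilizeIter m 0 ∧
          (s4Kernels.stabilizeIter m 1).map x.toMonoidHom = s4Kernels.stabilizeIter m 1 ∧
          (s4Kernels.stabilizeIter m 2).map c.toMonoidHom = s4Kernels.stabilizeIter m 2 ∧
          ∀ s, ρ s * (x (c s))⁻¹ ∈ M) →
      s4Kernels.stabilizeIter m 0 ⊔ s4Kernels.stabilizeIter m 1 ⊔ (s4Kernels.stabilizeIter m 2).map ρ.toMonoidHom = ⊤) ↔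
    (∀ γ : SurfaceGroup (3 + 3 * m) ≃* SurfaceGroup (3 + 3 * m), (∀ s, γ s * s⁻¹ ∈ M₀) →
      (∀ M : Subgroup (SurfaceGroup (3 + 3 * m)), M.Characteristic → M.FiniteIndex →
        ∃ x c : SurfaceGroup (3 + 3 * m) ≃* SurfaceGroup (3 + 3 * m),
          (s4Kernels.stabilizeIter m 0).map x.toMonoidHom = s4Kernels.stabilizeIter m 0 ∧
          (s4Kernels.stabilizeIter m 1).map x.toMonoidHom = s4Kernels.stabilizeIter m 1 ∧
          (s4Kernels.stabilizeIter m 2).map c.toMonoidHom = s4Kernels.stabilizeIter m 2 ∧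
          ∀ s, γ s * (x (c s))⁻¹ ∈ M) →
      s4Kernels.stabilizeIter m 0 ⊔ s4Kernels.stabilizeIter m 1 ⊔ (s4Kernels.stabilizeIter m 2).map γ.toMonoidHom = ⊤) :=
  ⟨fun hall γ _ hγ => hall γ hγ, fun hdeep ρ hρ => p3_of_deep M₀ hM₀ hF₀ hdeep ρ hρ⟩


/-! ## Registered form -/

/-- **Registered helper stub `stub_deepReduction`** (signature verbatim as registered on stmt-SmoothPoincare4-14596):
P3 at genus `3+3m` follows from its restriction to product-congruent automorphisms that are the identity modulo one
prescribed characteristic finite-index level `M₀`.  `= p3_of_deep`. [folklore] -/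
theorem stub_deepReduction : ∀ (m : ℕ) (M₀ : Subgroup (Literature.Topology.FourManifolds.SurfaceGroup (3 + 3 * m))), M₀.Characteristic → M₀.FiniteIndex → (∀ γ : Literature.Topology.FourManifolds.SurfaceGroup (3 + 3 * m) ≃* Literature.Topology.FourManifolds.SurfaceGroup (3 + 3 * m), (∀ s, γ s * s⁻¹ ∈ M₀) → (∀ M : Subgroup (Literature.Topology.FourManifolds.SurfaceGroup (3 + 3 * m)), M.Characteristic → M.FiniteIndex → ∃ x c : Literature.Topology.FourManifolds.SurfaceGroup (3 + 3 * m) ≃* Literature.Topology.FourManifolds.SurfaceGroup (3 + 3 * m), (Literature.Topology.FourManifolds.s4Kernels.stabilizeIter m 0).map x.toMonoidHom = Literature.Topology.FourManifolds.s4Kernels.stabilizeIter m 0 ∧ (Literature.Topology.FourManifolds.s4Kernels.stabilizeIter m 1).map x.toMonoidHom = Literature.Topology.FourManifolds.s4Kernels.stabilizeIter m 1 ∧ (Literature.Topology.FourManifolds.s4Kernels.stabilizeIter m 2).map c.toMonoidHom = Literature.Topology.FourManifolds.s4Kernels.stabilizeIter m 2 ∧ ∀ s, γ s * (x (c s))⁻¹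 ∈ M) → Literature.Topology.FourManifolds.s4Kernels.stabilizeIter m 0 ⊔ Literature.Topology.FourManifolds.s4Kernels.stabilizeIter m 1 ⊔ (Literature.Topology.FourManifolds.s4Kernels.stabilizeIter m 2).map γ.toMonoidHom = ⊤) → ∀ ρ : Literature.Topology.FourManifolds.SurfaceGroup (3 + 3 * m) ≃* Literature.Topology.FourManifolds.SurfaceGroup (3 + 3 * m), (∀ M : Subgroup (Literature.Topology.FourManifolds.SurfaceGroup (3 + 3 * m)), M.Characteristic → M.FiniteIndex → ∃ x c : Literature.Topology.FourManifolds.SurfaceGroup (3 + 3 * m) ≃* Literature.Topology.FourManifolds.SurfaceGroup (3 + 3 * m), (Literature.Topology.FourManifolds.s4Kernels.stabilizeIter m 0).map x.toMonoidHom = Literature.Topology.FourManifolds.s4Kernels.stabilizeIter m 0 ∧ (Literature.Topology.FourManifolds.s4Kernels.stabilizeIter m 1).map x.toMonoidHom = Literature.Topology.FourManifolds.s4Kernels.stabilizeIter m 1 ∧ (Literature.Topology.FourManifolds.s4Kernels.stabilizeIter m 2).map c.toMonoidHom = Literature.Topology.FourManifolds.s4Kernels.stabilizeIter m 2 ∧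 ∀ s, ρ s * (x (c s))⁻¹ ∈ M) → Literature.Topology.FourManifolds.s4Kernels.stabilizeIter m 0 ⊔ Literature.Topology.FourManifolds.s4Kernels.stabilizeIter m 1 ⊔ (Literature.Topology.FourManifolds.s4Kernels.stabilizeIter m 2).map ρ.toMonoidHom = ⊤ :=
  fun _ M₀ hM₀ hF₀ hdeep ρ hρ => p3_of_deep M₀ hM₀ hF₀ hdeep ρ hρ

end Summit.SmoothPoincare4.SmoothPoincare4.Theorems.HeegaardHandlebodyCongruenceClosed.PairRigidityRetraction

end
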